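import Summits.Parity.BatemanHorn.Theorems.RoughParitySectorsOddSectorShareLinearSieveDecouplingOddAux3
import Summits.Parity.BatemanHorn.Theorems.RoughParitySectorsOddSectorShareLinearSieveDecouplingOddAux5
import Summits.Parity.BatemanHorn.Theorems.RoughParitySectorsOddSectorShareLinearSieveDecouplingPrimeAux4
import Summits.Parity.BatemanHorn.Theorems.RoughParitySectorsOddSectorShareLinearOneFormShare
import Summits.Parity.BatemanHorn.Theorems.RoughValueTransportRoughValueLawSieveBand
import Literature.NumberTheory.Sieve.BatemanHornMertensProduct
import HarnessLib

/-!
# Route `RoughParitySectors`, crux `OddSectorShareLinear` (stmt-Parity-15629), line `birth`: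
# the registered stub `stub_sieveDecouplingOdd_of_roughCellsBV` (S'b | B: GIVEN the rough-cell Bombieri–Vinogradov theorem, sieving the other members out of the odd-rough values of f_m costs the sieve factor W_m)

`--supports stmt-Parity-15629` file of the checked skeleton
`Summits/Parity/BatemanHorn/Cruxes/OddSectorShareLinear/Lines/birth.lean`.  Target: ASSUMING the
registered stub `stub_roughCellsBV` (Bombieri–Vinogradov for the `Ω`-cells of the rough numbers at
level `X^{1/4}`, one reduced class per modulus), for every all-linear Bateman–Horn system `f`, member
`m`, `η > 0` there is `U₀` with: for `U ≥ U₀`, eventually in `x`, `|O_m − W_m·N_m| ≤ η·W_m·N_m`, where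
`O_m` is member `m`'s odd cell INSIDE the jointly rough set `R_f(x,U)`, `N_m` its one-form odd cell,
and `W_m(x,U) = ∏_{p < ⌈x^{1/U}⌉₊} (1 − g_m(p))`,
`g_m(p) = #{c mod p : p ∤ f_m(c), ∃ i ≠ m, p ∣ fᵢ(c)} / #{c mod p : p ∤ f_m(c)}`.

## Proof (the odd-side twin of `stub_sieveDecouplingPrime`)

* `f_m = αX + β`, `α ≥ 1`, no prime divides both `α, β`; classes `Ω p ⊊ Φ p`, density of dimension
  `2S` (`SieveDecoupling.exists_hasSieveDimension`), uniform Fundamental Lemma (constant `C₀`),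
  positivity threshold `n₀`; `U₀ = max(10, 5 log(4C₀/η))`.
* For `U ≥ U₀` the hypothesis at `n = ⌈U⌉ + 1`, `A = 2(2S+3) + 2S²` gives `C`; at a large height `x`
  (`y = αx + β`, `z' = x^{1/U}`, `D = x^{1/5}`, `αD ≤ y^{1/4}`) it yields a majorant `E` of all odd
  class discrepancies of `roughIcc ⌈z'⌉ y` with `∑_{q ≤ y^{1/4}} S^{ω(q)} E(q) ≤ C₂ y/(log y)^{2S+3}`
  (`SieveDecouplingOdd.exists_level_majorant`, file `…OddAux5`: worst classes, the odd cell as a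
  union of `Ω`-cells, Cauchy–Schwarz); the sieve at height `x` (`SieveDecouplingOdd.sieve_at`, file
  `…OddAux3`) gives `|O − WN| ≤ n₀ + (η/4) W (N + E₁) + R + W E₁` with
  `R = ∑_{d ∣ P(z'), d ≤ D} S^{ω(d)} E(αd) ≤ C₃ x/(log x)^{2S+3}` (`SieveDecoupling.sum_mul_reindex_le`)
  and `E₁ = E(α) ≤ R`-bound; these are `o(WN)` since `W ≥ w₀/(log x)^{2S}` and `N ≥ (c_N/2) x/log x`
  (`OneFormShare.tendsto_card_filter_odd`), absorbed by `SieveBand.eventually_absorb` and combined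
  by `SieveDecoupling.final_step`.
-/

noncomputable section

open Filter Finset Polynomial
open scoped BigOperators Topology
open Literature.NumberTheory.Sieve

namespace Summit.Parity.BatemanHorn.Cruxes.OddSectorShareLinear.Birth

open SieveDecoupling
open Summit.Parity.BatemanHorn.Cruxes.RoughValueLaw.IncrementAnchoring (SieveBand.exists_forall_eval_pos
  SieveBand.eventually_absorb LinearRoughValueLaw.const_of_linear)
open Summit.Parity.BatemanHorn.Cruxes.RoughValueLaw.OmegaClassShapeSplit (LinearCells.eventually_ranges)

/-- **Stub (S'b | B): sieve decoupling, odd side, GIVEN the rough-cell Bombieri–Vinogradov theorem** —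
registered stub `stub_sieveDecouplingOdd_of_roughCellsBV` of crux stmt-Parity-15629 (line `birth`), verbatim:
the hypothesis is the statement of the registered stub `stub_roughCellsBV` (level `X^{1/4}`), the conclusion
is the former stub `stub_sieveDecouplingOdd`. [folklore] -/
theorem stub_sieveDecouplingOdd_of_roughCellsBV :
    (∀ (n : ℕ) (A : ℝ), ∃ C : ℝ, 0 ≤ C ∧ ∀ X Y : ℝ, 2 ≤ Y → Y ≤ X → Real.log X ≤ n * Real.log Y → ∀
    (j : ℕ) (c : ℕ → ℕ), (∀ q : ℕ, 0 < q → (c q).Coprime q) → ∑ q ∈ Finset.Icc 1 ⌊X ^ ((1 : ℝ) /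
    4)⌋₊, |((((Literature.NumberTheory.Sieve.roughIcc ⌈Y⌉₊ ⌊X⌋₊).filter (fun b : ℕ =>
    ArithmeticFunction.cardFactors b = j + 1 ∧ Nat.ModEq q b (c q))).card : ℕ) : ℝ) -
    ((((Literature.NumberTheory.Sieve.roughIcc ⌈Y⌉₊ ⌊X⌋₊).filter (fun b : ℕ =>
    ArithmeticFunction.cardFactors b = j + 1 ∧ b.Coprime q)).card : ℕ) : ℝ) / ((Nat.totient q : ℕ) :
    ℝ)| ≤ C * X / Real.log X ^ A) → ∀ (k : ℕ) (f : Fin k → Polynomial ℤ),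
    Literature.NumberTheory.Sieve.IsBatemanHornSystem f → (∀ i, (f i).natDegree ≤ 1) → ∀ (m : Fin k)
    (η : ℝ), 0 < η → ∃ U₀ : ℝ, ∀ U : ℝ, U₀ ≤ U → ∀ᶠ x : ℕ in Filter.atTop, |(((((Finset.Icc 1
    x).filter (fun n : ℕ => ∀ i, 0 < (f i).eval (n : ℤ) ∧ ∀ p ∈ Finset.range ⌈(x : ℝ) ^ (((f
    i).natDegree : ℝ) / U)⌉₊, p.Prime → ¬ ((p : ℤ) ∣ (f i).eval (n : ℤ)))).filter (fun n : ℕ => Odd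
    (ArithmeticFunction.cardFactors (((f m).eval (n : ℤ)).toNat)))).card : ℕ) : ℝ) - (∏ p ∈
    Nat.primesBelow ⌈(x : ℝ) ^ (1 / U)⌉₊, (1 - ((((Finset.range p).filter (fun c : ℕ => ¬ ((p : ℤ) ∣
    (f m).eval (c : ℤ)) ∧ ∃ i, i ≠ m ∧ (p : ℤ) ∣ (f i).eval (c : ℤ))).card : ℕ) : ℝ) /
    ((((Finset.range p).filter (fun c : ℕ => ¬ ((p : ℤ) ∣ (f m).eval (c : ℤ)))).card : ℕ) : ℝ))) *
    ((((Finset.Icc 1 x).filter (fun n : ℕ => (0 < (f m).eval (n : ℤ) ∧ ∀ p ∈ Finset.range ⌈(x : ℝ) ^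
    (((f m).natDegree : ℝ) / U)⌉₊, p.Prime → ¬ ((p : ℤ) ∣ (f m).eval (n : ℤ))) ∧ Odd
    (ArithmeticFunction.cardFactors (((f m).eval (n : ℤ)).toNat)))).card : ℕ) : ℝ)| ≤ η * ((∏ p ∈
    Nat.primesBelow ⌈(x : ℝ) ^ (1 / U)⌉₊, (1 - ((((Finset.range p).filter (fun c : ℕ => ¬ ((p : ℤ) ∣
    (f m).eval (c : ℤ)) ∧ ∃ i, i ≠ m ∧ (p : ℤ) ∣ (f i).eval (c : ℤ))).card : ℕ) : ℝ) /
    ((((Finset.range p).filter (fun c : ℕ => ¬ ((p : ℤ) ∣ (f m).eval (c : ℤ)))).card : ℕ) : ℝ))) *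
    ((((Finset.Icc 1 x).filter (fun n : ℕ => (0 < (f m).eval (n : ℤ) ∧ ∀ p ∈ Finset.range ⌈(x : ℝ) ^
    (((f m).natDegree : ℝ) / U)⌉₊, p.Prime → ¬ ((p : ℤ) ∣ (f m).eval (n : ℤ))) ∧ Odd
    (ArithmeticFunction.cardFactors (((f m).eval (n : ℤ)).toNat)))).card : ℕ) : ℝ)) := by
  intro hBV k f hf hdeg m η hη
  -- the linear member `f_m = αX + β`
  have hdeg1 : ∀ i, (f i).natDegree = 1 := fun i => le_antisymm (hdeg i) (hf.natDegree_pos i)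
  obtain ⟨hα, hcop, -⟩ := LinearRoughValueLaw.const_of_linear (f := ![f m])
    (BatemanHornMertens.isBatemanHornSystem_single hf m) (hdeg1 m)
  simp only [Matrix.cons_val_zero] at hα hcop
  obtain ⟨α, hαdef⟩ : ∃ α : ℤ, α = (f m).coeff 1 := ⟨_, rfl⟩
  obtain ⟨β, hβdef⟩ : ∃ β : ℤ, β = (f m).coeff 0 := ⟨_, rfl⟩
  rw [← hαdef, ← hβdef] at hcop
  rw [← hαdef] at hα
  have hfm : ∀ n : ℤ, (f m).eval n = α * n + β := fun n => by
    conv_lhs => rw [eq_X_add_C_of_natDegree_le_one (hdeg m)]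
    simp only [eval_add, eval_mul, eval_C, eval_X, hαdef, hβdef]
  have hαβ : ∀ p : ℕ, p.Prime → (p : ℤ) ∣ α → ¬ ((p : ℤ) ∣ β) := by
    intro p hp hpa hpb
    have h1 : (p : ℤ) ∣ β % α := by rw [Int.emod_def]; exact dvd_sub hpb (hpa.mul_right _)
    have h2 : p ∣ (β % α).toNat := by
      rw [← Int.natCast_dvd_natCast, Int.toNat_of_nonneg (Int.emod_nonneg β hα.ne')]; exact h1
    have h3 : p ∣ α.toNat := by
      rw [← Int.natCast_dvd_natCast, Int.toNat_of_nonneg hα.le]; exact hpa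
    have h4 := Nat.dvd_gcd h2 h3
    rw [hcop.gcd_eq_one] at h4
    exact hp.one_lt.ne' (Nat.dvd_one.mp h4)
  -- classes, density, dimension, fundamental lemma, positivity threshold
  obtain ⟨Ωc, hΩ⟩ : ∃ Ωc : ℕ → Finset ℕ, ∀ p, Ωc p = (range p).filter (fun c : ℕ =>
      ¬ ((p : ℤ) ∣ (f m).eval (c : ℤ)) ∧ ∃ i, i ≠ m ∧ (p : ℤ) ∣ (f i).eval (c : ℤ)) :=
    ⟨_, fun _ => rfl⟩
  obtain ⟨Φc, hΦ⟩ : ∃ Φc : ℕ → Finset ℕ, ∀ p, Φc p = (range p).filter (fun c : ℕ =>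
      ¬ ((p : ℤ) ∣ (f m).eval (c : ℤ))) := ⟨_, fun _ => rfl⟩
  obtain ⟨g, hg⟩ : ∃ g : ArithmeticFunction ℝ,
      ∀ d : ℕ, d ≠ 0 → g d = ∏ p ∈ d.primeFactors, (#(Ωc p) : ℝ) / (#(Φc p) : ℝ) :=
    ⟨⟨fun d => if d = 0 then 0 else ∏ p ∈ d.primeFactors, (#(Ωc p) : ℝ) / (#(Φc p) : ℝ),
      if_pos rfl⟩, fun d hd => if_neg hd⟩
  have hgp : ∀ p : ℕ, p.Prime → g p = (#(Ωc p) : ℝ) / (#(Φc p) : ℝ) := fun p hp => by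
    rw [hg p hp.ne_zero, hp.primeFactors, prod_singleton]
  obtain ⟨S, hSdef⟩ : ∃ S : ℕ, S = ∑ i, (f i).natDegree := ⟨_, rfl⟩
  have hS1 : 1 ≤ S := by
    rw [hSdef, ← hdeg1 m]
    exact single_le_sum (f := fun i => (f i).natDegree) (fun i _ => Nat.zero_le _) (mem_univ m)
  have hSΩ : ∀ p : ℕ, p.Prime → #(Ωc p) ≤ S := fun p hp => hSdef ▸ card_Ω_le hf hΩ hp
  obtain ⟨K, hdim⟩ := exists_hasSieveDimension hf hΩ hΦ hgp hSdef.symm.le hS1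
  have hK1 : 1 ≤ K := hdim.one_le
  obtain ⟨C₀, hC₀, hFL⟩ := SieveSequence.fundamental_lemma_uniform_holds ((2 * S : ℕ) : ℝ) K
  obtain ⟨n₀, hn₀⟩ := SieveBand.exists_forall_eval_pos hf
  -- constants independent of `U`
  have hα'0 : 0 < α.toNat := by omega
  obtain ⟨w₀, hw₀⟩ : ∃ w₀ : ℝ, w₀ = Real.log 2 ^ (2 * S) / K := ⟨_, rfl⟩
  have hlog2 : 0 < Real.log 2 := Real.log_pos one_lt_two
  have hw₀0 : 0 < w₀ := by rw [hw₀]; positivity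
  have hαR : (0 : ℝ) < α := by exact_mod_cast hα
  -- the threshold `U₀`
  refine ⟨max 10 (5 * Real.log (4 * C₀ / η)), fun U hU => ?_⟩
  have hU10 : (10 : ℝ) ≤ U := (le_max_left _ _).trans hU
  have hU2 : (2 : ℝ) < U := by linarith
  have hU1 : (1 : ℝ) ≤ U := by linarith
  have hU0 : (0 : ℝ) < U := by linarith
  have heU : C₀ * Real.exp (-(U / 5)) ≤ η / 4 := by
    have h1 : Real.log (4 * C₀ / η) ≤ U / 5 := by
      have := (le_max_right _ _).trans hU; linarith
    have h2 : Real.exp (-(U / 5)) ≤ Real.exp (-Real.log (4 * C₀ / η)) :=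
      Real.exp_le_exp.mpr (by linarith)
    rw [Real.exp_neg (Real.log _), Real.exp_log (by positivity)] at h2
    calc C₀ * Real.exp (-(U / 5)) ≤ C₀ * (4 * C₀ / η)⁻¹ := mul_le_mul_of_nonneg_left h2 hC₀.le
      _ = η / 4 := by field_simp
  -- the Bombieri–Vinogradov constant for the depth `U`, and the constants depending on it
  obtain ⟨C, hC0, hC⟩ := hBV (⌈U⌉₊ + 1) (2 * ((2 * S + 3 : ℕ) : ℝ) + 2 * (S : ℝ) ^ 2)
  obtain ⟨C₂, hC₂⟩ : ∃ C₂ : ℝ, C₂ = Real.sqrt (4 * ((⌈U⌉₊ + 1 : ℕ) : ℝ) * ((⌈U⌉₊ + 1 : ℕ) : ℝ) *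
      C * Real.exp (2 * (S : ℝ) ^ 2 * 5)) := ⟨_, rfl⟩
  obtain ⟨C₃, hC₃⟩ : ∃ C₃ : ℝ, C₃ = max C₂ 1 * ((α : ℝ) + 1) * 2 ^ (2 * S + 3) := ⟨_, rfl⟩
  have hC₃0 : 0 < C₃ := by rw [hC₃]; positivity
  obtain ⟨cN, hcN⟩ : ∃ cN : ℝ, cN = (α : ℝ) / (((α.toNat).totient : ℕ) : ℝ) *
      ∑ i ∈ (range (⌈U⌉₊ + 1)).filter Even, roughCellDensity (i + 1) U := ⟨_, rfl⟩
  have hcN0 : 0 < cN := by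
    have hT : 1 ≤ ∑ i ∈ (range (⌈U⌉₊ + 1)).filter Even, roughCellDensity (i + 1) U := by
      have h0 : (0 : ℕ) ∈ (range (⌈U⌉₊ + 1)).filter Even :=
        mem_filter.mpr ⟨mem_range.mpr (Nat.succ_pos _), Even.zero⟩
      have h := single_le_sum (f := fun i => roughCellDensity (i + 1) U)
        (fun i _ => roughCellDensity_nonneg (i + 1) U) h0
      rwa [zero_add, roughCellDensity_one_of_one_le hU1] at h
    have hφ : (0 : ℝ) < (((α.toNat).totient : ℕ) : ℝ) := by exact_mod_cast Nat.totient_pos.mpr hα'0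
    rw [hcN]
    exact mul_pos (div_pos hαR hφ) (by linarith)
  obtain ⟨c₄, hc₄⟩ : ∃ c₄ : ℝ, c₄ = 3 * η / 4 * (w₀ * (cN / 2)) := ⟨_, rfl⟩
  have hc₄0 : 0 < c₄ := by rw [hc₄]; positivity
  -- names for the three quantities of the statement
  simp only [hdeg1, Nat.cast_one]
  obtain ⟨Pf, hPf⟩ : ∃ Pf : ℕ → ℝ, ∀ x : ℕ, Pf x = (#(((Icc 1 x).filter (fun n : ℕ => ∀ i,
      0 < (f i).eval (n : ℤ) ∧ ∀ p ∈ range ⌈(x : ℝ) ^ (1 / U)⌉₊, p.Prime →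
        ¬ ((p : ℤ) ∣ (f i).eval (n : ℤ)))).filter
      (fun n : ℕ => Odd (ArithmeticFunction.cardFactors (((f m).eval (n : ℤ)).toNat)))) : ℝ) :=
    ⟨_, fun _ => rfl⟩
  obtain ⟨Qf, hQf⟩ : ∃ Qf : ℕ → ℝ, ∀ x : ℕ, Qf x = (#((Icc 1 x).filter (fun n : ℕ =>
      (0 < (f m).eval (n : ℤ) ∧ ∀ p ∈ range ⌈(x : ℝ) ^ (1 / U)⌉₊, p.Prime →
        ¬ ((p : ℤ) ∣ (f m).eval (n : ℤ))) ∧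
      Odd (ArithmeticFunction.cardFactors (((f m).eval (n : ℤ)).toNat)))) : ℝ) := ⟨_, fun _ => rfl⟩
  obtain ⟨Wf, hWf⟩ : ∃ Wf : ℕ → ℝ, ∀ x : ℕ, Wf x = ∏ p ∈ Nat.primesBelow ⌈(x : ℝ) ^ (1 / U)⌉₊,
      (1 - ((#((range p).filter (fun c : ℕ => ¬ ((p : ℤ) ∣ (f m).eval (c : ℤ)) ∧
        ∃ i, i ≠ m ∧ (p : ℤ) ∣ (f i).eval (c : ℤ))) : ℕ) : ℝ) /
        ((#((range p).filter (fun c : ℕ => ¬ ((p : ℤ) ∣ (f m).eval (c : ℤ)))) : ℕ) : ℝ)) :=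
    ⟨_, fun _ => rfl⟩
  -- the eventualities
  have hQt := OneFormShare.tendsto_card_filter_odd (β := β) hα hcop hU2
  rw [← hcN] at hQt
  have hev2 := hQt.eventually_const_le (half_lt_self hcN0)
  have hκ₁ : 0 < c₄ / (4 * (η / 4 + 2)) := by positivity
  have hev4 := SieveBand.eventually_absorb (2 * S + 1) n₀ hκ₁
  have hev5 := (Real.tendsto_log_atTop.comp tendsto_natCast_atTop_atTop).eventually_ge_atTop
    (max 1 (2 * (η / 4 + 2) * C₃ / c₄))
  have hev6 := ((tendsto_rpow_atTop (by norm_num : (0 : ℝ) < 1 / 20)).comp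
    tendsto_natCast_atTop_atTop).eventually_ge_atTop (2 * (α.toNat : ℝ))
  have hev7 := ((tendsto_rpow_atTop (by positivity : (0 : ℝ) < 1 / U)).comp
    tendsto_natCast_atTop_atTop).eventually_ge_atTop (|(β : ℝ)| + 2)
  have key : ∀ᶠ x : ℕ in atTop, |Pf x - Wf x * Qf x| ≤ η * (Wf x * Qf x) := by
    filter_upwards [LinearCells.eventually_ranges (β := β) hα hU2, hev2, hev4, hev5, hev6, hev7,
      eventually_ge_atTop 6] with x hx1 hx2 hx4 hx5 hx6 hx7 hx8
    obtain ⟨hx0, hlogx, hz'2, hαz', hz'y, hlogle, hyx⟩ := hx1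
    simp only [Function.comp_apply] at hx5 hx6 hx7
    obtain ⟨z', hz'⟩ : ∃ z' : ℝ, z' = (x : ℝ) ^ (1 / U) := ⟨_, rfl⟩
    rw [← hz'] at hz'2 hz'y hx7 hαz' hlogle
    have hx6' : (6 : ℝ) ≤ x := by exact_mod_cast hx8
    have hx4' : (4 : ℝ) ≤ x := by linarith
    have hx1 : (1 : ℝ) ≤ x := by linarith
    have hαR1 : (1 : ℝ) ≤ α := by exact_mod_cast hα
    have hz1 : 1 < z' := by linarith
    -- exponents: `z' ≤ x^{1/5} = D`, `z' ≤ √x`, `z' ≤ x`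
    have hexp : ∀ r : ℝ, 1 / U ≤ r → z' ≤ (x : ℝ) ^ r := fun r hr => by
      rw [hz']; exact Real.rpow_le_rpow_of_exponent_le hx1 hr
    have hU5 : 1 / U ≤ 1 / 5 := one_div_le_one_div_of_le (by norm_num) (by linarith)
    have hxhalf := hexp (1 / 2) (hU5.trans (by norm_num))
    have hz'x : z' ≤ x := by
      have := hexp 1 (hU5.trans (by norm_num)); rwa [Real.rpow_one] at this
    obtain ⟨D, hD⟩ : ∃ D : ℝ, D = (x : ℝ) ^ (1 / 5 : ℝ) := ⟨_, rfl⟩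
    have hzD : z' ≤ D := hD ▸ hexp _ hU5
    -- `y = αx + β`
    obtain ⟨-, hyx2⟩ := half_le_linear hx4' hαR1 hx7 hxhalf
    have hzβ : β < ⌈z'⌉₊ := by
      have h : (β : ℝ) < ⌈z'⌉₊ := by linarith [le_abs_self (β : ℝ), Nat.le_ceil z']
      exact_mod_cast h
    have hzα : α < ⌈z'⌉₊ := by
      have h : (α : ℝ) < ⌈z'⌉₊ := hαz'.trans_le (Nat.le_ceil z')
      exact_mod_cast h
    have hy0 : 0 ≤ α * x + β := by
      have h : (0 : ℝ) ≤ α * x + β := by linarith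
      exact_mod_cast h
    obtain ⟨y, hy⟩ : ∃ y : ℕ, y = (α * x + β).toNat := ⟨_, rfl⟩
    have hyZ : ((y : ℕ) : ℤ) = α * x + β := by rw [hy]; exact Int.toNat_of_nonneg hy0
    have hyR : ((y : ℕ) : ℝ) = α * x + β := by exact_mod_cast hyZ
    rw [← hyR] at hyx2 hyx hz'y hlogle
    have hy3 : (3 : ℝ) ≤ y := by linarith
    have hlogy := log_half_le hx4' hyx2
    have hαD : (α.toNat : ℝ) * D ≤ (y : ℝ) ^ (1 / 4 : ℝ) := by rw [hD]; exact level_le hx0 hyx2 hx6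
    -- the rough-cell Bombieri–Vinogradov hypothesis at `X = y`, `Y = z'`, and the majorant `E`
    have hBVx := hC (y : ℝ) z' hz'2 hz'y hlogle
    simp only [Nat.floor_natCast] at hBVx
    obtain ⟨E, hE0, hEmaj, hlev⟩ := SieveDecouplingOdd.exists_level_majorant (J := ⌈U⌉₊ + 1)
      (S := S) hC0 hz1 hy3 hlogle hBVx
    rw [hy] at hEmaj
    -- the sieve at height `x`
    have hmain := SieveDecouplingOdd.sieve_at hf hΩ hΦ hα hfm hαβ hg hdim hC₀.le hFL hSΩ hn₀ hz'2
      hzD hzβ hzα hEmaj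
    have hPfx := hPf x
    have hQfx := hQf x
    rw [← hz'] at hPfx hQfx
    have hWg : ∏ p ∈ Nat.primesBelow ⌈z'⌉₊, (1 - g p) = Wf x := by
      rw [hWf, ← hz']
      exact prod_congr rfl fun p hp => by rw [hgp p (Nat.prime_of_mem_primesBelow hp), hΩ, hΦ]
    have he : Real.log D / Real.log z' = U / 5 := by
      rw [hD, hz']; exact log_rpow_div_log_rpow (by linarith) hU0.ne'
    rw [hWg, ← hPfx, ← hQfx, he] at hmain
    -- the remainder bound, transferred from `y` to `x`
    have hlev' : ∑ q ∈ Icc 1 ⌊(y : ℝ) ^ ((1 : ℝ) / 4)⌋₊,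
        (S : ℝ) ^ ArithmeticFunction.cardDistinctFactors q * E q ≤
          C₂ * y / Real.log y ^ (2 * S + 3) := by rw [hC₂]; exact hlev
    have hBt := bound_transfer (C := C₂) (n := 2 * S + 3) hlogx hlogy (by linarith) hyx
      (by linarith)
    rw [← hC₃] at hBt
    have hDset : ∀ d ∈ (primesProdBelow z').divisors.filter (fun d : ℕ => (d : ℝ) ≤ D),
        d ≠ 0 ∧ α.toNat * d ≤ ⌊(y : ℝ) ^ ((1 : ℝ) / 4)⌋₊ := by
      intro d hd
      rw [mem_filter, Nat.mem_divisors] at hd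
      refine ⟨ne_zero_of_dvd_ne_zero hd.1.2 hd.1.1, Nat.le_floor ?_⟩
      push_cast
      calc (α.toNat : ℝ) * d ≤ α.toNat * D := mul_le_mul_of_nonneg_left hd.2 (Nat.cast_nonneg _)
        _ ≤ _ := by rw [one_div]; rw [one_div] at hαD; exact hαD
    have hS1R : (1 : ℝ) ≤ S := by exact_mod_cast hS1
    have hRsum : ∑ d ∈ (primesProdBelow z').divisors.filter (fun d : ℕ => (d : ℝ) ≤ D),
        (S : ℝ) ^ ArithmeticFunction.cardDistinctFactors d * E (α.toNat * d) ≤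
          C₃ * x / Real.log x ^ (2 * S + 3) :=
      ((sum_mul_reindex_le hα'0 hDset hS1R hE0).trans hlev').trans hBt
    have hE1 : E α.toNat ≤ C₃ * x / Real.log x ^ (2 * S + 3) := by
      have h1 : (1 : ℕ) ∈ (primesProdBelow z').divisors.filter (fun d : ℕ => (d : ℝ) ≤ D) := by
        rw [mem_filter, Nat.mem_divisors, Nat.cast_one]
        exact ⟨⟨one_dvd _, primesProdBelow_ne_zero z'⟩, by linarith⟩
      have h2 := single_le_sum (f := fun d => (S : ℝ) ^ ArithmeticFunction.cardDistinctFactors d *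
          E (α.toNat * d)) (fun d _ => mul_nonneg (pow_nonneg (Nat.cast_nonneg _) _) (hE0 _)) h1
      simp only [ArithmeticFunction.cardDistinctFactors_one, pow_zero, one_mul, mul_one] at h2
      exact h2.trans hRsum
    -- lower bounds for `N` and `W`
    have hQlow : cN / 2 * x / Real.log x ≤ Qf x := by
      simp only [← hfm] at hx2
      rw [← hQf x] at hx2
      rw [div_le_iff₀ hlogx]
      have := (le_div_iff₀ hx0).mp hx2
      linarith
    have hWpos : 0 < Wf x := by
      rw [← hWg]
      exact prod_pos fun p hp => sub_pos.mpr (hdim.1 p (Nat.prime_of_mem_primesBelow hp)).2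
    have hW1 : Wf x ≤ 1 := by rw [← hWg]; exact prod_one_sub_le_one hdim z'
    have hWlow : w₀ / Real.log x ^ (2 * S) ≤ Wf x := by
      rw [← hWg, hw₀]; exact prod_one_sub_ge (n := 2 * S) hdim hz'2 hz'x
    -- absorbing the error terms
    obtain ⟨T, hT⟩ : ∃ T : ℝ, T = C₃ * x / Real.log x ^ (2 * S + 1 + 2) + 2 * (x : ℝ) ^ (1 / 2 : ℝ) :=
      ⟨_, rfl⟩
    have hsx0 : (0 : ℝ) ≤ (x : ℝ) ^ (1 / 2 : ℝ) := by positivity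
    have hpow : C₃ * x / Real.log x ^ (2 * S + 3) = C₃ * x / Real.log x ^ (2 * S + 1 + 2) := rfl
    have hE₁T : E α.toNat ≤ T := by rw [hT, ← hpow]; linarith
    have hRT : (∑ d ∈ (primesProdBelow z').divisors.filter (fun d : ℕ => (d : ℝ) ≤ D),
        (S : ℝ) ^ ArithmeticFunction.cardDistinctFactors d * E (α.toNat * d)) ≤ T := by
      rw [hT, ← hpow]; linarith
    have hQ0 : 0 ≤ Qf x := by rw [hQf]; exact Nat.cast_nonneg _
    have hsqx : ((x : ℝ) ^ (1 / 4 : ℝ)) ^ 2 = (x : ℝ) ^ (1 / 2 : ℝ) := by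
      rw [← Real.rpow_natCast, ← Real.rpow_mul hx0.le]; norm_num
    rw [hsqx] at hx4
    have hL1 : 1 ≤ Real.log x := (le_max_left _ _).trans hx5
    have hLbig : 2 * (η / 4 + 2) * C₃ / c₄ ≤ Real.log x := (le_max_right _ _).trans hx5
    have hjunk := junk_le (m := 2 * S + 1) hη hc₄0 hx0 (Nat.cast_nonneg n₀) hL1 hLbig hx4
      (le_rfl : C₃ * x / Real.log x ^ (2 * S + 1 + 2) ≤ _)
    have hjunk' : (n₀ : ℝ) + (η / 4 + 2) * T ≤ 3 * η / 4 * (Wf x * Qf x) := by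
      have h1 := main_term_ge (S := S) hη hw₀0 hcN0 hx0 hlogx hWlow hQlow hWpos.le
      rw [← hc₄] at h1
      refine le_trans ?_ h1
      rw [le_div_iff₀ (by positivity), hT]
      exact hjunk
    -- conclusion
    exact final_step hη hmain heU hWpos.le hW1 hQ0 (hE0 _) hE₁T hRT hjunk'
  simpa only [hPf, hQf, hWf] using key

end Summit.Parity.BatemanHorn.Cruxes.OddSectorShareLinear.Birth

end
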